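import Literature.NumberTheory.EllipticCurves.SelmerPInftyRelGaloisAction
import Literature.NumberTheory.EllipticCurves.SelmerPInftyRestriction
import Mathlib.FieldTheory.Galois.Basic
import HarnessLib

/-!
# The `Gal(L/K)`-action on `H¹(L, E_L[p^∞])` in the subgroup model, for `E/K` and `L/K` Galois

The relative companion of `Literature.NumberTheory.EllipticCurves.SelmerPInftyModelAction` (which
treats `E/ℚ` and a Galois *quadratic* number field). For a Weierstrass curve `E = W` over a
number field `K`, a finite **Galois** extension `L/K` of number fields, `σ₀ ∈ Gal(L/K)` and a
prime `p`:

* `RelModel.index_galRange`, `RelModel.galRange_eq_galSubgroupClosure`,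
  `RelModel.normal_galRange` — for `L/K` Galois the image `galRange L` of `Γ_L → Γ_K` has index
  `[L : K]` (the transported lifts `liftToAbsGal L σ₀`, `σ₀ ∈ Gal(L/K)`, lie in distinct cosets),
  hence equals the open normal subgroup `Γ_{L̃} = galSubgroupClosure L` of the same index which it
  contains, and is normal (the degree-`2` case is the tree's `index_galRange`, `normal_galRange`);
  the transported lifts are a full system of coset representatives
  (`RelModel.exists_liftToAbsGal_inv_mul_mem_galRange`);
* `RelModel.modelIso_relConjH1Primary` — **the action in the subgroup model**: under
  `modelIso : H¹(Γ_L, E_L[p^∞]) ≃ H¹(galRange L, E[p^∞])` of `SelmerPInftyRestriction`, the action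
  of the chosen lift of `σ₀` on `H¹(L, E_L[p^∞])` (`IsLiftOfAut.relConjH1Primary`, file
  `SelmerPInftyRelGaloisAction`) is the conjugation action
  (`Literature.NumberTheory.EllipticCurves.conjH1`) of the transported lift
  `liftToAbsGal L σ₀ ∈ Γ_K` on `H¹(galRange L, E[p^∞])`. Both are maps of compatible pairs
  `Γ_L ⇉ galRange L`, `E_L[p^∞] ⇉ E[p^∞]`, which agree on the nose
  (`RelModel.resGal_conjGalCMH`, `RelModel.primaryBaseChangeEquiv_smul_liftToAbsGal`) — verbatim
  the argument of `modelIso_conjH1Primary`, with `ℚ` replaced by `K`.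

This is the bookkeeping that makes `Sel_{p^∞}(E/F)`, transported into `H¹(Gal(K̄/F), E[p^∞])`,
a `Gal(F/K)`-stable subgroup on which `Gal(F/K)` acts by conjugation (Dokchitser–Dokchitser,
Ann. of Math. 172 (2010), Lemma 4.14 and Cor. 4.15, for `E` over a number field `K`).
Everything here is proved; no named fact is introduced. Declarations are grouped in the
sub-namespace `RelModel` (the relative subgroup model), the unprefixed names being those of the
quadratic/`ℚ` case in `SelmerPInftyModelAction`.

## References

* T. Dokchitser, V. Dokchitser, Ann. of Math. 172 (2010), Lemma 4.14, Cor. 4.15.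
  [DokchitserDokchitserAnnals2010]
* J.-P. Serre, *Galois Cohomology* (1997), I.§2.4–2.5, II.§1.1. [SerreGaloisCohomology1997]
-/

noncomputable section

open scoped Classical

universe u

namespace Literature.NumberTheory.EllipticCurves

namespace RelModel

open GaloisRepresentations WeierstrassCurve

/-! ## `galRange L` for `L/K` finite Galois: index `[L : K]`, normal -/

section GaloisRange

variable {K : Type u} [Field K] [NumberField K] (L : Type u) [Field L] [NumberField L]
  [Algebra K L]

/-- Distinct elements of `Aut(L/K)` have transported lifts in distinct cosets of `galRange L`:
if `(c_σ)⁻¹ c_{σ'} ∈ galRange L` then `σ = σ'` (both sides act on the copy `j(L) ⊆ K̄` of `L`,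
on which `galRange L` acts trivially and `c_σ` acts as `σ`). [folklore] -/
theorem liftToAbsGal_injective_mod_galRange {σ σ' : L ≃ₐ[K] L}
    (h : (liftToAbsGal (K := K) L σ)⁻¹ * liftToAbsGal (K := K) L σ' ∈ galRange (K := K) L) :
    σ = σ' := by
  ext x
  have hfix := smul_embIntoClosure_of_mem_galRange L h x
  change (show AlgebraicClosure K ≃ₐ[K] AlgebraicClosure K from liftToAbsGal (K := K) L σ).symm
      ((show AlgebraicClosure K ≃ₐ[K] AlgebraicClosure K from liftToAbsGal (K := K) L σ')
        (embIntoClosure (K := K) L x)) = embIntoClosure (K := K) L x at hfix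
  rw [liftToAbsGal_embIntoClosure, AlgEquiv.symm_apply_eq, liftToAbsGal_embIntoClosure] at hfix
  exact ((embIntoClosure (K := K) L).injective hfix).symm

variable [IsGalois K L]

/-- **For `L/K` finite Galois, `galRange L` has index `[L : K]` in `Γ_K`**: it contains
`Γ_{L̃}`, of index `[L̃ : K] = [L : K]` (`index_galSubgroupClosure_eq_finrank_of_isGalois`), so its
index divides `[L : K]`; and the `[L : K] = #Gal(L/K)` transported lifts `liftToAbsGal L σ₀` lie in
distinct cosets (`liftToAbsGal_injective_mod_galRange`), so its index is at least `[L : K]`.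
(The tree's `index_galRange` is the case `[L : K] = 2`.) Serre, *Galois Cohomology*, II.§1.1.
[folklore] -/
theorem index_galRange : (galRange (K := K) L).index = Module.finrank K L := by
  haveI : FiniteDimensional K L := Module.Finite.of_restrictScalars_finite ℚ K L
  have hle : galSubgroupClosure (K := K) L ≤ galRange (K := K) L := galSubgroupClosure_le_galRange L
  haveI : (galRange (K := K) L).FiniteIndex := Subgroup.finiteIndex_of_le hle
  have hdvd : (galRange (K := K) L).index ∣ Module.finrank K L :=
    index_galSubgroupClosure_eq_finrank_of_isGalois (K := K) L ▸ Subgroup.index_dvd_of_le hle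
  -- the cosets of the transported lifts are distinct
  let φ : (L ≃ₐ[K] L) → Field.absoluteGaloisGroup K ⧸ galRange (K := K) L :=
    fun σ ↦ (liftToAbsGal (K := K) L σ : Field.absoluteGaloisGroup K ⧸ galRange (K := K) L)
  have hφ : Function.Injective φ := fun σ σ' hσ ↦
    liftToAbsGal_injective_mod_galRange L (QuotientGroup.eq.mp hσ)
  haveI : Finite (Field.absoluteGaloisGroup K ⧸ galRange (K := K) L) :=
    Subgroup.finite_quotient_of_finiteIndex
  have hcard : Module.finrank K L ≤ (galRange (K := K) L).index := by
    rw [← IsGalois.card_aut_eq_finrank K L, Subgroup.index]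
    exact Nat.card_le_card_of_injective φ hφ
  exact le_antisymm (Nat.le_of_dvd Module.finrank_pos hdvd) hcard

/-- **For `L/K` finite Galois, `galRange L = Γ_{L̃}`** (`galSubgroupClosure L`, the absolute
Galois group of the Galois closure of the copy of `L` in `K̄`, here `L` itself): it contains it
and both have index `[L : K]`. [folklore] -/
theorem galRange_eq_galSubgroupClosure : galRange (K := K) L = galSubgroupClosure (K := K) L := by
  have hle : galSubgroupClosure (K := K) L ≤ galRange (K := K) L := galSubgroupClosure_le_galRange L
  haveI : (galRange (K := K) L).FiniteIndex := Subgroup.finiteIndex_of_le hle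
  have hidx : (galSubgroupClosure (K := K) L).index = (galRange (K := K) L).index := by
    rw [index_galSubgroupClosure_eq_finrank_of_isGalois (K := K) L, index_galRange (K := K) L]
  have hrel := Subgroup.relIndex_mul_index hle
  rw [hidx] at hrel
  have h1 : (galSubgroupClosure (K := K) L).relIndex (galRange (K := K) L) = 1 := by
    have hne : (galRange (K := K) L).index ≠ 0 := Subgroup.FiniteIndex.index_ne_zero
    have : (galSubgroupClosure (K := K) L).relIndex (galRange (K := K) L) *
        (galRange (K := K) L).index = 1 * (galRange (K := K) L).index := by rw [hrel, one_mul]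
    exact Nat.eq_of_mul_eq_mul_right (Nat.pos_of_ne_zero hne) this
  exact le_antisymm (Subgroup.relIndex_eq_one.mp h1) hle

/-- **For `L/K` finite Galois, `galRange L` is normal in `Γ_K`** (it is `Γ_{L̃}`,
`normal_galSubgroupClosure`). (The tree's `normal_galRange` is the case `[L : K] = 2`.)
[folklore] -/
theorem normal_galRange : (galRange (K := K) L).Normal := by
  rw [galRange_eq_galSubgroupClosure (K := K) L]
  infer_instance

omit [IsGalois K L] in
/-- `galRange L` has finite index in `Γ_K` (it contains `Γ_{L̃}`). [folklore] -/
theorem finiteIndex_galRange : (galRange (K := K) L).FiniteIndex :=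
  Subgroup.finiteIndex_of_le (galSubgroupClosure_le_galRange L)

/-- For `L/K` finite Galois, every `g ∈ Γ_K` has its `[L : K]`-th power in `galRange L`
(the quotient `Γ_K / galRange L` is a group of order `[L : K]`). [folklore] -/
theorem pow_finrank_mem_galRange (g : Field.absoluteGaloisGroup K) :
    g ^ Module.finrank K L ∈ galRange (K := K) L := by
  haveI := normal_galRange (K := K) L
  haveI := finiteIndex_galRange (K := K) L
  rw [← index_galRange (K := K) L, ← QuotientGroup.eq_one_iff, QuotientGroup.mk_pow, Subgroup.index]
  exact pow_card_eq_one'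

/-- **`Γ_K = ⋃_{σ₀ ∈ Gal(L/K)} (liftToAbsGal L σ₀) · galRange L`** for `L/K` finite Galois: the
transported lifts form a complete system of coset representatives (they lie in distinct cosets,
`liftToAbsGal_injective_mod_galRange`, and there are `[L : K] = (Γ_K : galRange L)` of them). So
every `g ∈ Γ_K` is `c_{σ₀} n` with `n ∈ galRange L`. Serre, *Galois Cohomology*, II.§1.1.
[folklore] -/
theorem exists_liftToAbsGal_inv_mul_mem_galRange (g : Field.absoluteGaloisGroup K) :
    ∃ σ₀ : L ≃ₐ[K] L, (liftToAbsGal (K := K) L σ₀)⁻¹ * g ∈ galRange (K := K) L := by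
  haveI : FiniteDimensional K L := Module.Finite.of_restrictScalars_finite ℚ K L
  haveI := finiteIndex_galRange (K := K) L
  let φ : (L ≃ₐ[K] L) → Field.absoluteGaloisGroup K ⧸ galRange (K := K) L :=
    fun σ ↦ (liftToAbsGal (K := K) L σ : Field.absoluteGaloisGroup K ⧸ galRange (K := K) L)
  have hφ : Function.Injective φ := fun σ σ' hσ ↦
    liftToAbsGal_injective_mod_galRange L (QuotientGroup.eq.mp hσ)
  have hcard : Nat.card (Field.absoluteGaloisGroup K ⧸ galRange (K := K) L) ≤ Nat.card (L ≃ₐ[K] L) := by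
    rw [IsGalois.card_aut_eq_finrank K L, ← Subgroup.index, index_galRange (K := K) L]
  obtain ⟨σ₀, hσ₀⟩ := (hφ.bijective_of_nat_card_le hcard).2 (g : _ ⧸ galRange (K := K) L)
  exact ⟨σ₀, QuotientGroup.eq.mp hσ₀⟩

end GaloisRange

/-! ## The action of `Gal(L/K)` in the subgroup model -/

section Action

variable {K : Type u} [Field K] [NumberField K] (L : Type u) [Field L] [NumberField L]
  [Algebra K L] (W : WeierstrassCurve K) (p : ℕ) (σ₀ : L ≃ₐ[K] L)

/-- `e (c₀⁻¹ y) = τ₀⁻¹ (e y)` for the transported lift `c₀ = liftToAbsGal L σ₀` of `σ₀`, its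
lift `τ₀ = liftAut σ₀` to `L̄`, and `e : K̄ ≃ L̄` the chosen isomorphism. [folklore] -/
theorem algEquivOfEmb_liftToAbsGal_symm_apply (y : AlgebraicClosure K) :
    algEquivOfEmb L (closureEmb (K := K) L)
        ((show AlgebraicClosure K ≃ₐ[K] AlgebraicClosure K from liftToAbsGal (K := K) L σ₀).symm y) =
      (liftAut σ₀).symm (algEquivOfEmb L (closureEmb (K := K) L) y) := by
  apply (liftAut σ₀).injective
  refine ((algEquivOfEmb_liftToAbsGal_apply L σ₀ _).symm.trans ?_).trans
    ((liftAut σ₀).apply_symm_apply _).symm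
  exact congrArg (algEquivOfEmb L (closureEmb (K := K) L))
    ((show AlgebraicClosure K ≃ₐ[K] AlgebraicClosure K from
      liftToAbsGal (K := K) L σ₀).apply_symm_apply y)

/-- **The Galois sides agree**: restricting `τ₀⁻¹ g τ₀ ∈ Γ_L` to `K̄` gives `c₀⁻¹ (g|K̄) c₀`.
[folklore] -/
theorem resGal_conjGalCMH (g : Field.absoluteGaloisGroup L) :
    resGal (K := K) L ((isLiftOfAut_liftAut σ₀).conjGalCMH g) =
      (liftToAbsGal (K := K) L σ₀)⁻¹ * resGal (K := K) L g * liftToAbsGal (K := K) L σ₀ := by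
  apply AlgEquiv.ext
  intro z
  apply (algEquivOfEmb L (closureEmb (K := K) L)).injective
  refine (algEquivOfEmb_resGal_apply L _ z).trans ?_
  change (liftAut σ₀).symm ((show AlgebraicClosure L ≃ₐ[L] AlgebraicClosure L from g)
      (liftAut σ₀ (algEquivOfEmb L (closureEmb (K := K) L) z))) =
    algEquivOfEmb L (closureEmb (K := K) L)
      ((show AlgebraicClosure K ≃ₐ[K] AlgebraicClosure K from liftToAbsGal (K := K) L σ₀).symm
        ((show AlgebraicClosure K ≃ₐ[K] AlgebraicClosure K from resGal (K := K) L g)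
          ((show AlgebraicClosure K ≃ₐ[K] AlgebraicClosure K from liftToAbsGal (K := K) L σ₀) z)))
  refine Eq.trans ?_ (algEquivOfEmb_liftToAbsGal_symm_apply L σ₀ _).symm
  refine Eq.trans ?_ (congrArg (fun w ↦ (liftAut σ₀).symm w) (algEquivOfEmb_resGal_apply L g _).symm)
  exact congrArg (fun w ↦ (liftAut σ₀).symm ((show AlgebraicClosure L ≃ₐ[L] AlgebraicClosure L from g) w))
    (algEquivOfEmb_liftToAbsGal_apply L σ₀ z).symm

variable {L} in
omit [NumberField K] [NumberField L] in
/-- The coefficient isomorphism `E(L̄) = E_L(L̄)` on an affine point. [folklore] -/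
theorem localPointsEquivGeomPoints_some {x y : AlgebraicClosure L}
    (h : (W.baseChange (AlgebraicClosure L)).toAffine.Nonsingular x y) :
    ∃ h' : ((W.baseChange L).baseChange (AlgebraicClosure L)).toAffine.Nonsingular x y,
      localPointsEquivGeomPoints W L (Affine.Point.some x y h) = Affine.Point.some x y h' :=
  ⟨(baseChange_baseChange W L (AlgebraicClosure L)).symm ▸ h,
    Affine.Point.congrEquiv_some (baseChange_baseChange W L (AlgebraicClosure L)).symm h⟩

variable {L} in
omit [NumberField K] [NumberField L] in
/-- A lift `τ` of `σ ∈ Aut(L/K)` on an affine point of `X_L(L̄)`, `X/K`: `τ (x, y) = (τ x, τ y)`.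
(The tree's `IsLiftOfAut.pointsMap_some` for `X/ℚ`.) [folklore] -/
theorem pointsMap_some {σ : L ≃ₐ[K] L} {τ : AlgebraicClosure L ≃+* AlgebraicClosure L}
    (hτ : IsLiftOfAut σ τ) (X : WeierstrassCurve K) {x y : AlgebraicClosure L}
    (h : ((X.baseChange L).baseChange (AlgebraicClosure L)).toAffine.Nonsingular x y) :
    ∃ h', hτ.pointsMap X (show geomPoints (X.baseChange L) from .some x y h) =
      (show geomPoints (X.baseChange L) from .some (τ x) (τ y) h') := by
  refine ⟨?_, ?_⟩
  · exact (WeierstrassCurve.Affine.baseChange_nonsingular (W := X.toAffine)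
      (A := AlgebraicClosure L) (B := AlgebraicClosure L) (S := K) (f := hτ.algEquiv.toAlgHom)
      (hτ.algEquiv).injective x y).mpr h
  · rfl

variable {L} in
/-- **The coefficient sides agree**: moving a point of `E(K̄)` by `c₀` and then to `E_L(L̄)` along
the chosen embedding is moving it to `E_L(L̄)` and then applying `τ₀` to the coordinates.
[folklore] -/
theorem localPointsEquivGeomPoints_pointsMap_smul (Q : geomPoints W) :
    localPointsEquivGeomPoints W L (pointsMap W L (liftToAbsGal (K := K) L σ₀ • Q)) =
      (isLiftOfAut_liftAut σ₀).pointsMap W (localPointsEquivGeomPoints W L (pointsMap W L Q)) := by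
  change (W.baseChange (AlgebraicClosure K)).toAffine.Point at Q
  rcases Q with _ | ⟨x, y, h⟩
  · change localPointsEquivGeomPoints W L (pointsMap W L 0) =
      (isLiftOfAut_liftAut σ₀).pointsMap W (localPointsEquivGeomPoints W L (pointsMap W L 0))
    simp only [map_zero]
  · -- both sides are affine points; compute them
    have hcx : (W.baseChange (AlgebraicClosure K)).toAffine.Nonsingular
        ((show AlgebraicClosure K ≃ₐ[K] AlgebraicClosure K from liftToAbsGal (K := K) L σ₀) x)
        ((show AlgebraicClosure K ≃ₐ[K] AlgebraicClosure K from liftToAbsGal (K := K) L σ₀) y) :=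
      (WeierstrassCurve.Affine.baseChange_nonsingular (W := W.toAffine)
        (f := ((show AlgebraicClosure K ≃ₐ[K] AlgebraicClosure K from
          liftToAbsGal (K := K) L σ₀) : AlgebraicClosure K →ₐ[K] AlgebraicClosure K))
        (AlgEquiv.injective _) x y).mpr h
    have hι : ∀ {a b : AlgebraicClosure K}, (W.baseChange (AlgebraicClosure K)).toAffine.Nonsingular a b →
        (W.baseChange (AlgebraicClosure L)).toAffine.Nonsingular (closureEmb (K := K) L a)
          (closureEmb (K := K) L b) := fun hab ↦
      (WeierstrassCurve.Affine.baseChange_nonsingular (W := W.toAffine)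
        (f := closureEmb (K := K) L) (closureEmb (K := K) L).injective _ _).mpr hab
    obtain ⟨h2, e2⟩ := localPointsEquivGeomPoints_some W (L := L) (hι hcx)
    obtain ⟨h4, e4⟩ := localPointsEquivGeomPoints_some W (L := L) (hι h)
    obtain ⟨h5, e5⟩ := pointsMap_some (isLiftOfAut_liftAut σ₀) W h4
    have e5' : (isLiftOfAut_liftAut σ₀).pointsMap W (Affine.Point.some _ _ h4) =
        Affine.Point.some _ _ h5 := e5
    change localPointsEquivGeomPoints W L (Affine.Point.some _ _ (hι hcx)) =
      (isLiftOfAut_liftAut σ₀).pointsMap W (localPointsEquivGeomPoints W L (Affine.Point.some _ _ (hι h)))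
    rw [e2, e4, e5']
    exact Affine.Point.some_eq_some_of_eq (algEquivOfEmb_liftToAbsGal_apply L σ₀ x)
      (algEquivOfEmb_liftToAbsGal_apply L σ₀ y)

variable {L} in
/-- The coefficient sides agree on `E[p^∞]`: `τ₀ (ι P) = ι (c₀ • P)` for the coefficient
isomorphism `ι = primaryBaseChangeEquiv`. [folklore] -/
theorem primaryBaseChangeEquiv_smul_liftToAbsGal (P : geomPrimaryTorsion W p) :
    (isLiftOfAut_liftAut σ₀).relPrimaryTorsionMap W p (primaryBaseChangeEquiv L W p P) =
      primaryBaseChangeEquiv L W p (liftToAbsGal (K := K) L σ₀ • P) := by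
  apply Subtype.ext
  rw [IsLiftOfAut.coe_relPrimaryTorsionMap, primaryBaseChangeEquiv_apply, primaryBaseChangeEquiv_apply,
    coe_primaryBaseChangeMap, coe_primaryBaseChangeMap, primaryComponent.coe_smul]
  exact (localPointsEquivGeomPoints_pointsMap_smul W σ₀ _).symm

/-- **The action of `Gal(L/K)` in the subgroup model.** For `L/K` finite Galois and
`σ₀ ∈ Gal(L/K)`: `modelIso (τ₀_* s) = (c₀)_* (modelIso s)`, where `τ₀_* = relConjH1Primary` is
the action of the chosen lift `τ₀` of `σ₀` on `H¹(L, E_L[p^∞])` (`E = W/K`) and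
`(c₀)_* = conjH1 … (liftToAbsGal L σ₀)` is the conjugation action on `H¹(galRange L, E[p^∞])`
(normal subgroup by `normal_galRange`). Serre, *Galois Cohomology*, I.§2.5; Dokchitser–Dokchitser
2010, Lemma 4.14 (the `G`-action on `H¹(F, E[p^∞])`). (The tree's `modelIso_conjH1Primary` is the
case `K = ℚ`, `[L : K] = 2`.) [cite: DokchitserDokchitserAnnals2010, Lemma 4.14] -/
theorem modelIso_relConjH1Primary [IsGalois K L] (s : galH1Primary (W.baseChange L) p) :
    haveI := normal_galRange (K := K) L
    modelIso L W p ((isLiftOfAut_liftAut σ₀).relConjH1Primary W p s) =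
      conjH1 (galRange (K := K) L) (geomPrimaryTorsion W p) (liftToAbsGal (K := K) L σ₀)
        (modelIso L W p s) := by
  haveI := normal_galRange (K := K) L
  have hG : ((isLiftOfAut_liftAut σ₀).conjGalCMH).comp (rangeToResGal (K := K) L) =
      (rangeToResGal (K := K) L).comp
        (subgroupConj (galRange (K := K) L) (liftToAbsGal (K := K) L σ₀)) := by
    apply ContinuousMonoidHom.ext
    intro n
    apply resGal_injective (K := K) L
    change resGal (K := K) L ((isLiftOfAut_liftAut σ₀).conjGalCMH (rangeToResGal (K := K) L n)) =
      resGal (K := K) L (rangeToResGal (K := K) L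
        (subgroupConj (galRange (K := K) L) (liftToAbsGal (K := K) L σ₀) n))
    rw [resGal_conjGalCMH, resGal_rangeToResGal, resGal_rangeToResGal, subgroupConj_apply_coe]
  have hM : ((primaryBaseChangeEquiv L W p).symm.toAddMonoidHom).comp
        ((isLiftOfAut_liftAut σ₀).relPrimaryTorsionMap W p) =
      (DistribSMul.toAddMonoidHom (geomPrimaryTorsion W p) (liftToAbsGal (K := K) L σ₀)).comp
        (primaryBaseChangeEquiv L W p).symm.toAddMonoidHom := by
    refine AddMonoidHom.ext fun m ↦ ?_
    apply (primaryBaseChangeEquiv L W p).injective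
    change primaryBaseChangeEquiv L W p ((primaryBaseChangeEquiv L W p).symm
        ((isLiftOfAut_liftAut σ₀).relPrimaryTorsionMap W p m)) =
      primaryBaseChangeEquiv L W p (liftToAbsGal (K := K) L σ₀ • (primaryBaseChangeEquiv L W p).symm m)
    rw [AddEquiv.apply_symm_apply, ← primaryBaseChangeEquiv_smul_liftToAbsGal,
      AddEquiv.apply_symm_apply]
  rw [modelIso_apply, modelIso_apply, IsLiftOfAut.relConjH1Primary, conjH1, resH1Hom_resH1Hom,
    resH1Hom_resH1Hom]
  exact congrFun (congrArg DFunLike.coe (resH1Hom_congr hG hM _ _)) s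

end Action

end RelModel

end Literature.NumberTheory.EllipticCurves
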